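import Summits.BirchSwinnertonDyer.BirchSwinnertonDyer.Theorems.ResidualThetaTransportAtTwoPlusDualLayerOmega
import HarnessLib

/-!
# (d′) transport tools: polynomial operators through a realization `ι : A → S` of `A ⊗ ℚ_p/ℤ_p`, independence modulo `p` lifts to
# independence modulo `p^J` (no `p`-torsion), and `p^{J·R}` honest classes from `R` independent points

Routes `ResidualThetaTransportAtTwo` (RTT, crux r201 `ResidualLambdaFormulaNegDiscAtTwo`, stmt-BirchSwinnertonDyer-23110) /
`ThetaPartnerAtTwo`. Seat `prover-bsd-wall-tp2-p2x-w3` g13; `--supports stmt-BirchSwinnertonDyer-23110` (brick (d′) of the ISO / H-PLUSDUAL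
plan: «honest plus classes of layer `n` = `S[2^J, ω⁺_n]` = `ω̃⁻_n·S[2^J, ω_n]`», Kim 2007 Prop. 3.15 step (b)). THEOREMS ONLY (no definition,
no named fact, no instance, no `sorry`); PURE ALGEBRA; closes nothing.

SETTING (the realization currency of (R1)@2 `PlusDual.nonempty_linearEquiv_iwasawaAlgebra_two`, abstracted): an abelian group `L` with an
additive endomorphism `γ` (there: `E(K̄_v)` with `σ_g`), a `γ`-stable subgroup `A ≤ L` (there: `⋃ₙ E⁺(ℚ_{2,n})`), an abelian group `S` with
`φ ∈ End(S)`, and additive maps `ι_k : A → S` («`x ↦ x ⊗ p^{-k}`») with `φ ∘ ι_k = ι_k ∘ γ`.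
* §1 **`aeval_sub_one_apply_iota`**: every `Q ∈ ℤ[T]` satisfies `Q(φ − 1)(ι_k x) = ι_k (Q(γ − 1) x)` — so the ANNIHILATION
  `ω⁺_n(σ_g − 1)·E⁺_n = 0` (`SignedEC.PlusOmega.aeval_X_mul_cyclotomicOmegaPlus_apply_eq_zero`) transports to `ω⁺_n(φ − 1)·ι_k(E⁺_n) = 0`;
  `pow_nsmul_iota_eq_zero`: `p^k · ι_k x = 0` from `ι_0 = 0`, `p ι_{k+1} = ι_k`.
* §2 **`forall_pow_dvd_of_indep_mod`**: points `x₁,…,x_R` of a subgroup `T` without `p`-torsion that are independent modulo `p·T` are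
  independent modulo `p^J·T` (induction on `J`).
* §3 **`le_ncard_image_iota_of_indep`**: with `ker ι_J ⊆ p^J·T` («`hker`» of the realization) the `p^{J R}` combinations
  `ι_J(∑ cᵢ xᵢ)`, `0 ≤ cᵢ < p^J`, are pairwise distinct — so any subset of `S` containing them has at least `p^{J·R}` elements; this is the
  RANK input of the counting shell `eq_torsionBy_ker_of_subset_of_le_ncard`.

HONEST FRAMING: closes nothing; ISO / 23110 NOT proved; BSD is not proved by any of this.
References: [BDKim2007] Prop. 3.15 (proof, step «`Ê(m_n) ⊗ ℚ_p/ℤ_p = H_n[ω_n]`»), Prop. 3.17; [Kobayashi2003] Thm. 6.2, Prop. 8.12;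
[GreenbergLNM1716] §1 p. 60.
-/

set_option autoImplicit false
-- D-0017: single-problem summit, so `Summit.BirchSwinnertonDyer.BirchSwinnertonDyer.…` repeats a namespace BY DESIGN.
set_option linter.dupNamespace false

noncomputable section

open scoped Classical
open Polynomial

namespace Summit.BirchSwinnertonDyer.BirchSwinnertonDyer.Theorems.ResidualThetaLayer.PlusDual

/-! ## §1 Polynomial operators through a realization -/

section Transport

variable {L : Type*} [AddCommGroup L] (γ : AddMonoid.End L) (A : AddSubgroup L)
variable {S : Type*} [AddCommGroup S] (φ : AddMonoid.End S) (ι : A →+ S)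

/-- A `γ`-stable subgroup is stable under every integer polynomial in `γ − 1`. [folklore] -/
theorem aeval_sub_one_mem (hA : ∀ a ∈ A, γ a ∈ A) (Q : ℤ[X]) {a : L} (ha : a ∈ A) : Polynomial.aeval (γ - 1) Q a ∈ A := by
  induction Q using Polynomial.induction_on' generalizing a with
  | add P Q hP hQ =>
    rw [map_add]
    exact add_mem (hP ha) (hQ ha)
  | monomial n c =>
    rw [Polynomial.aeval_monomial, eq_intCast]
    show (c : AddMonoid.End L) (((γ - 1) ^ n) a) ∈ A
    rw [AddMonoid.End.intCast_apply]
    refine AddSubgroup.zsmul_mem A ?_ c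
    induction n generalizing a with
    | zero => rwa [pow_zero, AddMonoid.End.one_apply]
    | succ n ih =>
      rw [pow_succ]
      show ((γ - 1) ^ n) ((γ - 1) a) ∈ A
      refine ih ?_
      show γ a - a ∈ A
      exact sub_mem (hA a ha) ha

/-- **Polynomial operators pass through a realization**: if `φ (ι x) = ι (γ x)` for all `x ∈ A`, then for every `Q ∈ ℤ[T]`,
`Q(φ − 1)(ι x) = ι (Q(γ − 1) x)`. (With `Q = T·ω̃⁺_n` and the annihilation of the plus points this gives `ω⁺_n(φ − 1)·ι(E⁺_n) = 0`.)
[cite: GreenbergLNM1716, §1 p. 60 (`T = γ − 1`)] [cite: BDKim2007, Prop. 3.15 (proof)] -/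
theorem aeval_sub_one_apply_iota (hA : ∀ a ∈ A, γ a ∈ A) (hequiv : ∀ x : A, φ (ι x) = ι ⟨γ x, hA x x.2⟩)
    (Q : ℤ[X]) (x : A) :
    Polynomial.aeval (φ - 1) Q (ι x) =
      ι ⟨Polynomial.aeval (γ - 1) Q (x : L), aeval_sub_one_mem γ A hA Q x.2⟩ := by
  -- it suffices to treat `x ↦ ι ⟨P x, _⟩` uniformly: prove the statement for all `y : A` with `(y : L) = Q(γ−1) x`
  suffices h : ∀ (y : A), (y : L) = Polynomial.aeval (γ - 1) Q (x : L) →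
      Polynomial.aeval (φ - 1) Q (ι x) = ι y from h _ rfl
  induction Q using Polynomial.induction_on' with
  | add P Q hP hQ =>
    intro y hy
    rw [map_add] at hy ⊢
    have hy' : y = ⟨_, aeval_sub_one_mem γ A hA P x.2⟩ + ⟨_, aeval_sub_one_mem γ A hA Q x.2⟩ := Subtype.ext hy
    rw [hy', map_add, ← hP ⟨_, aeval_sub_one_mem γ A hA P x.2⟩ rfl, ← hQ ⟨_, aeval_sub_one_mem γ A hA Q x.2⟩ rfl]
    rfl
  | monomial n c =>
    intro y hy
    rw [Polynomial.aeval_monomial, eq_intCast] at hy ⊢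
    -- powers first: `((φ−1)^m)(ι x) = ι ⟨((γ−1)^m) x, _⟩`
    have hpow : ∀ (m : ℕ) (z : A), (z : L) = ((γ - 1) ^ m) (x : L) → ((φ - 1) ^ m) (ι x) = ι z := by
      intro m
      induction m with
      | zero =>
        intro z hz
        rw [pow_zero, AddMonoid.End.one_apply] at hz ⊢
        rw [show z = x from Subtype.ext hz]
      | succ m ih =>
        intro z hz
        -- `w := ((γ−1)^m) x ∈ A`, `z = (γ − 1) w`
        have hwA : ((γ - 1) ^ m) (x : L) ∈ A := by
          have := aeval_sub_one_mem γ A hA ((X : ℤ[X]) ^ m) x.2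
          rwa [map_pow, Polynomial.aeval_X] at this
        have hw := ih ⟨_, hwA⟩ rfl
        rw [pow_succ'] at hz ⊢
        show (φ - 1) (((φ - 1) ^ m) (ι x)) = ι z
        rw [hw]
        have hz' : z = ⟨γ (((γ - 1) ^ m) (x : L)), hA _ hwA⟩ - ⟨_, hwA⟩ := Subtype.ext (by
          rw [hz, AddSubgroupClass.coe_sub]; rfl)
        rw [hz', map_sub, ← hequiv ⟨_, hwA⟩]
        rfl
    have hzA : ((γ - 1) ^ n) (x : L) ∈ A := by
      have := aeval_sub_one_mem γ A hA ((X : ℤ[X]) ^ n) x.2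
      rwa [map_pow, Polynomial.aeval_X] at this
    have hy' : y = c • (⟨_, hzA⟩ : A) := Subtype.ext (by
      rw [hy, AddSubgroupClass.coe_zsmul]; exact AddMonoid.End.intCast_apply c _)
    rw [hy', map_zsmul, ← hpow n ⟨_, hzA⟩ rfl]
    exact AddMonoid.End.intCast_apply c _

/-- In a realization with `ι_0 = 0` and `p·ι_{k+1} = ι_k` («`x ⊗ p^{-k}`») every `ι_k x` is killed by `p^k`. [folklore] -/
theorem pow_nsmul_iota_eq_zero {p : ℕ} (ιs : ℕ → (A →+ S)) (h0 : ∀ x, ιs 0 x = 0)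
    (hsucc : ∀ (k : ℕ) (x : A), p • ιs (k + 1) x = ιs k x) (k : ℕ) (x : A) : p ^ k • ιs k x = 0 := by
  induction k with
  | zero => rw [pow_zero, one_smul, h0]
  | succ k ih => rw [pow_succ, mul_smul, hsucc, ih]

end Transport

/-! ## §2 Independence modulo `p` lifts to independence modulo `p^J` -/

section Indep

variable {L : Type*} [AddCommGroup L] {p : ℕ}

/-- **Independence modulo `p` ⟹ independence modulo `p^J`** in a subgroup `T` without `p`-torsion: if every relation
`∑ cᵢ xᵢ = p·y` (`y ∈ T`) forces `p ∣ cᵢ`, then every relation `∑ cᵢ xᵢ = p^J·y` (`y ∈ T`) forces `p^J ∣ cᵢ` (peel off one `p`,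
cancel it by torsion-freeness, induct). [cite: Kobayashi2003, Prop. 8.7 (no p-torsion in the tower)] -/
theorem forall_pow_dvd_of_indep_mod (T : AddSubgroup L) (hnt : ∀ y ∈ T, p • y = 0 → y = 0) {R : ℕ} (x : Fin R → L)
    (hxT : ∀ i, x i ∈ T) (hind : ∀ (c : Fin R → ℤ), ∀ y ∈ T, ∑ i, c i • x i = p • y → ∀ i, (p : ℤ) ∣ c i)
    (J : ℕ) (c : Fin R → ℤ) {y : L} (hy : y ∈ T) (hrel : ∑ i, c i • x i = p ^ J • y) : ∀ i, (p : ℤ) ^ J ∣ c i := by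
  induction J generalizing c y with
  | zero => intro i; rw [pow_zero]; exact one_dvd _
  | succ J ih =>
    rw [pow_succ', mul_smul] at hrel
    have hdvd := hind c (p ^ J • y) (T.nsmul_mem hy _) hrel
    choose d hd using hdvd
    -- `p • (∑ dᵢ xᵢ − p^J y) = 0`
    have hsum : ∑ i, c i • x i = p • ∑ i, d i • x i := by
      rw [Finset.smul_sum]
      exact Finset.sum_congr rfl fun i _ ↦ by rw [hd i, mul_smul, natCast_zsmul]
    have hzero : p • (∑ i, d i • x i - p ^ J • y) = 0 := by rw [smul_sub, ← hsum, hrel, sub_self]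
    have hmem : ∑ i, d i • x i - p ^ J • y ∈ T :=
      sub_mem (T.sum_mem fun i _ ↦ T.zsmul_mem (hxT i) _) (T.nsmul_mem hy _)
    have hrel' : ∑ i, d i • x i = p ^ J • y := sub_eq_zero.mp (hnt _ hmem hzero)
    intro i
    rw [hd i, pow_succ']
    exact mul_dvd_mul_left _ (ih d hy hrel' i)

/-- A vector of integers with `p^J ∣ cᵢ − c'ᵢ` and `0 ≤ cᵢ, c'ᵢ < p^J` has `c = c'`. [folklore] -/
theorem funext_of_pow_dvd_sub {R J : ℕ} {c c' : Fin R → ℕ} (hc : ∀ i, c i < p ^ J) (hc' : ∀ i, c' i < p ^ J)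
    (hdvd : ∀ i, (p : ℤ) ^ J ∣ (c i : ℤ) - (c' i : ℤ)) : c = c' := by
  funext i
  have h := hdvd i
  rw [← Nat.cast_pow] at h
  have := Int.eq_zero_of_dvd_of_natAbs_lt_natAbs h (by
    rw [Int.natAbs_natCast]
    have h1 := hc i; have h2 := hc' i
    omega)
  omega

end Indep

/-! ## §3 Counting honest classes -/

section Count

variable {L : Type*} [AddCommGroup L] {S : Type*} [AddCommGroup S] {p : ℕ}

/-- **`p^{J·R}` honest classes from `R` independent points.** Let `A ≤ T ≤ L` with `T` free of `p`-torsion, `ι_J : A → S` additive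
with `ker ι_J ⊆ p^J·A` (the realization axiom «`hker`»), and `x₁,…,x_R ∈ A` independent modulo `p·T`. Then the classes
`ι_J(∑ cᵢ xᵢ)`, `0 ≤ cᵢ < p^J`, are pairwise distinct; any finite `P ⊆ S` containing them has `#P ≥ p^{J·R}`.
[cite: BDKim2007, Prop. 3.15 (proof) and Prop. 3.17] [cite: Kobayashi2003, Thm. 6.2] -/
theorem le_ncard_of_indep (T A : AddSubgroup L) (hAT : A ≤ T) (hnt : ∀ y ∈ T, p • y = 0 → y = 0) (ιJ : A →+ S) (J : ℕ)
    (hker : ∀ x : A, ιJ x = 0 → ∃ w : A, (x : L) = p ^ J • (w : L)) {R : ℕ} (x : Fin R → L) (hxA : ∀ i, x i ∈ A)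
    (hind : ∀ (c : Fin R → ℤ), ∀ y ∈ T, ∑ i, c i • x i = p • y → ∀ i, (p : ℤ) ∣ c i)
    (P : Set S) (hPfin : P.Finite)
    (hP : ∀ c : Fin R → ℕ, (∀ i, c i < p ^ J) →
      ιJ ⟨∑ i, (c i : ℤ) • x i, A.sum_mem fun i _ ↦ A.zsmul_mem (hxA i) _⟩ ∈ P) :
    p ^ (J * R) ≤ P.ncard := by
  -- the combination map on `Fin R → Fin (p^J)`
  let f : (Fin R → Fin (p ^ J)) → S := fun c ↦ ιJ ⟨∑ i, ((c i : ℕ) : ℤ) • x i, A.sum_mem fun i _ ↦ A.zsmul_mem (hxA i) _⟩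
  have hf : Function.Injective f := by
    intro c c' hcc'
    have hzero : ιJ ⟨∑ i, (((c i : ℕ) : ℤ) - ((c' i : ℕ) : ℤ)) • x i, A.sum_mem fun i _ ↦ A.zsmul_mem (hxA i) _⟩ = 0 := by
      have e : (⟨∑ i, (((c i : ℕ) : ℤ) - ((c' i : ℕ) : ℤ)) • x i, A.sum_mem fun i _ ↦ A.zsmul_mem (hxA i) _⟩ : A) =
          ⟨∑ i, ((c i : ℕ) : ℤ) • x i, A.sum_mem fun i _ ↦ A.zsmul_mem (hxA i) _⟩ -
            ⟨∑ i, ((c' i : ℕ) : ℤ) • x i, A.sum_mem fun i _ ↦ A.zsmul_mem (hxA i) _⟩ :=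
        Subtype.ext (by simp only [AddSubgroupClass.coe_sub, sub_smul, Finset.sum_sub_distrib])
      rw [e, map_sub, sub_eq_zero]
      exact hcc'
    obtain ⟨w, hw⟩ := hker _ hzero
    have hdvd := forall_pow_dvd_of_indep_mod T hnt x (fun i ↦ hAT (hxA i)) hind J
      (fun i ↦ ((c i : ℕ) : ℤ) - ((c' i : ℕ) : ℤ)) (hAT w.2) hw
    have := funext_of_pow_dvd_sub (p := p) (R := R) (J := J) (c := fun i ↦ (c i : ℕ)) (c' := fun i ↦ (c' i : ℕ))
      (fun i ↦ (c i).2) (fun i ↦ (c' i).2) hdvd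
    funext i
    exact Fin.ext (congrFun this i)
  have hsub : Set.range f ⊆ P := by
    rintro _ ⟨c, rfl⟩
    exact hP (fun i ↦ (c i : ℕ)) fun i ↦ (c i).2
  calc p ^ (J * R) = Nat.card (Fin R → Fin (p ^ J)) := by
        rw [Nat.card_eq_fintype_card, Fintype.card_fun, Fintype.card_fin, Fintype.card_fin, ← pow_mul]
    _ = (Set.range f).ncard := (Set.ncard_range_of_injective hf).symm
    _ ≤ P.ncard := Set.ncard_le_ncard hsub hPfin

end Count

end Summit.BirchSwinnertonDyer.BirchSwinnertonDyer.Theorems.ResidualThetaLayer.PlusDual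

end
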